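import Literature.Analysis.Matrix.TorusGreenGradientDecay
import Literature.Analysis.Matrix.FiniteRangeDecompositionPowSymmetry
import Literature.Analysis.Fourier.ConvolutionOperatorReflection
import HarnessLib

/-!
# Volume-uniform decay of the torus Green's function gradients, III: the single temporal difference

`Literature/Analysis/Matrix/`; completes `TorusGreenGradientDecay.lean` with the one case where the scale-by-scale momentum
bounds are not summable uniformly in the temporal period: a SINGLE temporal difference `∇_{e₂} G`.  In the quasi-one-dimensional
scales `L < 2^N ≤ M` each piece contributes `O(1/L²)` to `∇_{e₂}C_N` (its one-dimensional size), `log₂(M/L)` of them — but the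
true contribution of a piece at scale `2^N ≫ |t|` is smaller by `|t|/2^N`, because the kernel is EVEN under time reflection: its
temporal derivative vanishes at the mirror to first order.  Under a time-reflection symmetry `τ` of `A` (an additive automorphism
with `τ e₂ = −e₂` fixing the spatial part `w` of the separation; every piece inherits it, `FiniteRangeDecompositionPowSymmetry`),
`ConvolutionOperatorReflection.abs_rowDiff_le_of_reflection` turns the summable SECOND-difference bounds
(`abs_rowDiffs_frdPiecePow_far_temporal_le`, `k = 2`) into `|∇_{e₂} C_N (x, x + w + n e₂)| ≤ (|n| + 2)(K₂ + 2K₁)/(2^N L²)`,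
and the finite range of the pieces (`2^N ≳ |n|/(8mR)` for a non-zero contribution) makes the sum `O(mR/L²)`:

* `abs_rowDiff_pinv_le_temporal_one` — `|∇_{e₂} pinv A (x, x + w + n e₂)| ≤ 2K₃/max(1,(d − 1)/(2mR))² + 16mR(K₂ + 2K₁)/L²`
  for `|n| ≤ d = d(x, x + w + n e₂)`, `m ≥ 2`: the dipole decay of the temporal gradient, uniformly in `L ≤ M`.

All [folklore].
-/

noncomputable section

open Finset Real
open Literature.Analysis.Fourier Literature.Analysis.Fourier.TrigApprox

namespace Literature.Analysis.Matrix

variable {G : Type*} [AddCommGroup G] [Fintype G] [DecidableEq G]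

section TemporalOne

variable {A : _root_.Matrix G G ℝ}

/-- **Dipole decay of the single temporal gradient of the torus Green's function.**  Under the hypotheses of
`TorusGreenGradientDecay.lean`, a time-reflection symmetry `τ` of `A` (`τ e₂ = −e₂`, `A (τ x) (τ y) = A x y`), range `R ≥ 1`
and `m ≥ 2`: for every `x`, every `τ`-fixed `w` and every integer `n` with `|n| ≤ d(x, y)`, `y = x + w + n•e₂`,
`|∇_{e₂} pinv A (x,y)| ≤ 2K₃ / max(1, (d(x,y) − 1)/(2mR))² + 16 m R (K₂ + 2K₁) / L²`
(`K₃ = (27m(2π)/4)(1 + 2⁵π^{2m+2}/(16c₀)^{m+1})`, `K₂ = (27m(2π)²/4)(1 + 5·2⁴π^{2m+2}/(16c₀)^{m+1})`,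
`K₁ = 27m(2π)²π^{2m+2}2⁶/(4(16c₀)^{m+1})` — the `k = 1` resp. `k = 2` constants of parts III, VI, VII). [folklore] -/
theorem abs_rowDiff_pinv_le_temporal_one
    (e : Fin 3 → G) (Ls : Fin 3 → ℕ) (hL : ∀ i, Ls i ≠ 0) (he : ∀ i, Ls i • e i = 0)
    (hgen : ∀ ψ φ : AddChar G ℂ, (∀ i, ψ (e i) = φ (e i)) → ψ = φ)
    (hcard : ∏ i, (Ls i : ℝ) ≤ Fintype.card G) (hL01 : Ls 1 = Ls 0) (hLM : Ls 0 ≤ Ls 2)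
    (hA : IsTranslationInvariant A) (hs : A.IsHermitian) (hP : A.PosSemidef)
    (h4 : ((4 : ℝ) • (1 : _root_.Matrix G G ℝ) - A).PosSemidef)
    {c₀ : ℝ} (hc₀ : 0 < c₀)
    (hcoer : ∀ ψ : AddChar G ℂ, c₀ * ∑ i, (2 - 2 * (ψ (e i)).re) ≤ (symbol A ψ).re)
    (h1 : symbol A 1 = 0)
    {d : G → G → ℕ} (htri : ∀ i j k, d i k ≤ d i j + d j k) (hd0 : ∀ i, d i i = 0)
    (hstep : ∀ (i : Fin 3) (x : G), d x (x + e i) ≤ 1 ∧ d x (x - e i) ≤ 1)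
    {R : ℕ} (hR : HasFiniteRange d R A) (hR1 : 1 ≤ R)
    (τ : G ≃+ G) (hτA : ∀ x y, A (τ x) (τ y) = A x y) (hτe : τ (e 2) = -e 2)
    {m : ℕ} (hm : 2 ≤ m) (x w : G) (hτw : τ w = w) (n : ℤ) (hnD : n.natAbs ≤ d x (x + w + n • e 2)) :
    |rowDiff (e 2) (pinv A) x (x + w + n • e 2)|
      ≤ 2 * (27 * m * (2 * π) / 4 * (1 + 2 ^ 5 * π ^ (2 * m + 2) / (16 * c₀) ^ (m + 1)))
            * (1 / max 1 (((d x (x + w + n • e 2) : ℝ) - 1) / (2 * m * R))) ^ 2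
        + 16 * m * R * ((27 * m * (2 * π) ^ 2 / 4 * (1 + 5 * 2 ^ 4 * π ^ (2 * m + 2) / (16 * c₀) ^ (m + 1)))
              + 2 * (27 * m * (2 * π) ^ 2 * π ^ (2 * m + 2) * 2 ^ 6 / (4 * (16 * c₀) ^ (m + 1))))
            / (Ls 0 : ℝ) ^ 2 := by
  set y := x + w + n • e 2 with hy
  set D : ℝ := (d x y : ℝ) with hD
  set θ : ℝ := (D - 1) / (2 * m * R) with hθ
  have hm1 : 1 ≤ m := by omega
  have hLpos : (0 : ℝ) < (Ls 0 : ℝ) := Nat.cast_pos.mpr (Nat.pos_of_ne_zero (hL 0))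
  have hL1 : (1 : ℝ) ≤ (Ls 0 : ℝ) := by exact_mod_cast Nat.pos_of_ne_zero (hL 0)
  have hMpos : (0 : ℝ) < (Ls 2 : ℝ) := Nat.cast_pos.mpr (Nat.pos_of_ne_zero (hL 2))
  have h0 := symbol_eq_zero_iff_eq_one e Ls hL he hgen hL01 hLM hc₀ hcoer h1
  have ha₀ : (0 : ℝ) < 16 * c₀ / (Ls 2 : ℝ) ^ 2 := by positivity
  have hmin := symbol_re_ge_of_ne_one e Ls hL he hgen hL01 hLM hc₀ hcoer
  have hmR : (0 : ℝ) < 2 * m * R := by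
    have : (0 : ℝ) < (R : ℝ) := by exact_mod_cast hR1
    positivity
  -- the single-step list
  have hl : ∀ g ∈ [e 2], ∃ i, g = e i ∨ g = -e i := by
    intro g hg; simp only [List.mem_singleton] at hg; exact ⟨2, Or.inl hg⟩
  have hl_len : ∀ g ∈ [e 2], ∀ z, d z (z + g) ≤ 1 := by
    intro g hg z; simp only [List.mem_singleton] at hg; subst hg; exact (hstep 2 z).1
  -- (0) vanishing below the scale of the separation
  have hvan : ∀ N : ℕ, (2 : ℝ) ^ N < θ → rowDiffs [e 2] (frdPiecePow A m N) x y = 0 := by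
    intro N hN
    refine rowDiffs_apply_eq_zero_of_lt_dist htri (hasFiniteRange_frdPiecePow htri hd0 hR m N) hl_len ?_
    by_contra hcon
    push Not at hcon
    rw [hθ, lt_div_iff₀ hmR] at hN
    have : ((2 * m * 2 ^ N * R + [e 2].length : ℕ) : ℝ) ≥ D := by rw [hD]; exact_mod_cast hcon
    simp only [List.length_singleton] at this
    push_cast at this
    nlinarith
  -- (1) the three-dimensional scales, `k = 1`
  have h3D : ∀ N : ℕ, (2 : ℝ) ^ N ≤ (Ls 0 : ℝ) → |rowDiffs [e 2] (frdPiecePow A m N) x y|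
      ≤ (27 * m * (2 * π) / 4 * (1 + 2 ^ 5 * π ^ (2 * m + 2) / (16 * c₀) ^ (m + 1))) * ((1 : ℝ) / 2 ^ N) ^ 2 := by
    intro N hN
    have hN' : (2 ^ N : ℕ) ≤ Ls 0 := by exact_mod_cast hN
    have hLN : ∀ i, 2 ^ N ≤ Ls i := by
      intro i; fin_cases i
      · exact hN'
      · simp only [Fin.mk_one]; rw [hL01]; exact hN'
      · exact hN'.trans hLM
    have h := abs_rowDiffs_frdPiecePow_apply_le_inv_pow e Ls he hgen hcard hA hs hP h4 hc₀ hcoer m N hLN [e 2] hl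
      (by simp only [List.length_cons, List.length_nil]; omega) x y
    simp only [List.length_cons, List.length_nil, zero_add, Nat.reduceAdd, pow_one] at h
    rwa [one_div_pow, ← div_eq_mul_one_div]
  -- (2) the far scales: evenness turns the second-difference bound into `(|n|+2)(K₂+2K₁)/(2^N L²)`
  set Ks : ℝ := (27 * m * (2 * π) ^ 2 / 4 * (1 + 5 * 2 ^ 4 * π ^ (2 * m + 2) / (16 * c₀) ^ (m + 1)))
      + 2 * (27 * m * (2 * π) ^ 2 * π ^ (2 * m + 2) * 2 ^ 6 / (4 * (16 * c₀) ^ (m + 1))) with hKs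
  have hKs0 : 0 ≤ Ks := by rw [hKs]; positivity
  have hfar : ∀ N : ℕ, (Ls 0 : ℝ) < (2 : ℝ) ^ N → |rowDiffs [e 2] (frdPiecePow A m N) x y|
      ≤ ((|n| : ℤ) + 2 : ℝ) * Ks * ((1 : ℝ) / 2 ^ N) ^ 1 * (1 / (Ls 0 : ℝ) ^ 2) := by
    intro N hN
    -- second differences of the piece, uniformly in the points
    have hB : ∀ (x' : G) (n' : ℤ), |rowDiffs [e 2, e 2] (frdPiecePow A m N) x' (x' + w + n' • e 2)| ≤ Ks * ((1 : ℝ) / 2 ^ N) * (1 / (Ls 0 : ℝ) ^ 2) := by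
      intro x' n'
      have h := abs_rowDiffs_frdPiecePow_far_temporal_le (m := m) e Ls hL he hgen hcard hL01 hLM hA hs hP h4 hc₀ hcoer N hN [e 2, e 2]
        (by simp) (by simp) (by simp only [List.length_cons, List.length_nil]; omega) x' (x' + w + n' • e 2)
      simp only [List.length_cons, List.length_nil, zero_add, Nat.reduceAdd, Nat.reduceSub, pow_one] at h
      rw [← hKs] at h
      exact h
    -- the piece is reflection symmetric
    have hτC : ∀ a b, frdPiecePow A m N (τ a) (τ b) = frdPiecePow A m N a b :=
      fun a b => frdPiecePow_apply_equiv τ.toEquiv hτA m N a b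
    have hτ : ∀ j : ℤ, τ (w + j • e 2) = w + (-j) • e 2 := by
      intro j
      rw [map_add, hτw, map_zsmul, hτe, smul_neg, neg_smul]
    have hev := abs_rowDiff_le_of_reflection (isTranslationInvariant_frdPiecePow hA m N) τ hτC (map_zero τ) hτ hB x n
    rw [rowDiffs_cons, rowDiffs_nil]
    refine hev.trans (le_of_eq ?_)
    push_cast
    ring
  -- core assembly with `q = 2`, `p = 1`, `E = 1/L²`
  have hnn : (0 : ℝ) ≤ ((|n| : ℤ) + 2 : ℝ) * Ks := by positivity
  have hcore := abs_rowDiffs_pinv_le_core hA hs hP h4 h0 ha₀ hmin hm1 (List.cons_ne_nil (e 2) []) x y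
    (by positivity) hnn (by positivity : (0 : ℝ) ≤ 1 / (Ls 0 : ℝ) ^ 2) le_rfl (by norm_num : 1 ≤ 2) hvan h3D hfar
  rw [rowDiffs_cons, rowDiffs_nil] at hcore
  refine hcore.trans (add_le_add le_rfl ?_)
  -- `(|n|+2)/max(1,θ,L) ≤ 8mR`
  rw [pow_one]
  have hratio : ((|n| : ℤ) + 2 : ℝ) * (1 / max 1 (max θ (Ls 0 : ℝ))) ≤ 8 * m * R := by
    have hmax1 : (1 : ℝ) ≤ max 1 (max θ (Ls 0 : ℝ)) := le_max_left _ _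
    have hmaxpos : (0 : ℝ) < max 1 (max θ (Ls 0 : ℝ)) := by linarith
    rw [← div_eq_mul_one_div, div_le_iff₀ hmaxpos]
    have h8 : (16 : ℝ) ≤ 8 * m * R := by
      have hm' : (2 : ℝ) ≤ m := by exact_mod_cast hm
      have hR' : (1 : ℝ) ≤ R := by exact_mod_cast hR1
      nlinarith
    by_cases hn2 : (|n| : ℤ) ≤ 1
    · have : ((|n| : ℤ) : ℝ) ≤ 1 := by exact_mod_cast hn2
      nlinarith
    · -- `|n| ≥ 2`: `θ ≥ (|n| − 1)/(2mR) ≥ (|n| + 2)/(8mR)`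
      push Not at hn2
      have hn2' : (2 : ℝ) ≤ ((|n| : ℤ) : ℝ) := by exact_mod_cast hn2
      have hDn : ((|n| : ℤ) : ℝ) ≤ D := by
        rw [hD]
        have : (n.natAbs : ℝ) ≤ (d x y : ℝ) := by exact_mod_cast hnD
        have hcast : ((n.natAbs : ℕ) : ℝ) = ((|n| : ℤ) : ℝ) := by rw [← Int.cast_natCast, Int.natCast_natAbs]
        rwa [hcast] at this
      have hθge : (((|n| : ℤ) : ℝ) - 1) / (2 * m * R) ≤ θ := by
        rw [hθ]; exact div_le_div_of_nonneg_right (by linarith) hmR.le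
      have hθmax : θ ≤ max 1 (max θ (Ls 0 : ℝ)) := (le_max_left _ _).trans (le_max_right _ _)
      have key : ((|n| : ℤ) : ℝ) + 2 ≤ 8 * m * R * ((((|n| : ℤ) : ℝ) - 1) / (2 * m * R)) := by
        rw [show 8 * m * R * ((((|n| : ℤ) : ℝ) - 1) / (2 * m * R)) = 4 * (((|n| : ℤ) : ℝ) - 1) by field_simp; ring]
        linarith
      calc ((|n| : ℤ) + 2 : ℝ) ≤ 8 * m * R * ((((|n| : ℤ) : ℝ) - 1) / (2 * m * R)) := by exact_mod_cast key
        _ ≤ 8 * m * R * max 1 (max θ (Ls 0 : ℝ)) := by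
            refine mul_le_mul_of_nonneg_left (hθge.trans hθmax) (by positivity)
  calc 2 * (((|n| : ℤ) + 2 : ℝ) * Ks) * (1 / max 1 (max θ (Ls 0 : ℝ))) * (1 / (Ls 0 : ℝ) ^ 2)
      = 2 * ((((|n| : ℤ) + 2 : ℝ)) * (1 / max 1 (max θ (Ls 0 : ℝ)))) * Ks * (1 / (Ls 0 : ℝ) ^ 2) := by ring
    _ ≤ 2 * (8 * m * R) * Ks * (1 / (Ls 0 : ℝ) ^ 2) := by gcongr
    _ = 16 * m * R * Ks / (Ls 0 : ℝ) ^ 2 := by ring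

end TemporalOne

end Literature.Analysis.Matrix

end
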